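import Summits.ResolutionOfSingularities.ResolutionOfSingularities.Theses.PAlteration
import Summits.ResolutionOfSingularities.ResolutionOfSingularities.Theorems.PAlterationPalterationThesisPialtOfPerfect
import Summits.ResolutionOfSingularities.ResolutionOfSingularities.Theorems.PAlterationPialtReductions
import Summits.ResolutionOfSingularities.ResolutionOfSingularities.Theorems.PAlterationPialtKnownCases
import Summits.ResolutionOfSingularities.ResolutionOfSingularities.Theorems.PAlterationPialtFrobenius
import Summits.ResolutionOfSingularities.ResolutionOfSingularities.Theorems.PAlterationPialtRadicialCover
import Summits.ResolutionOfSingularities.ResolutionOfSingularities.Theorems.PAlterationPicoverToRadicialBottomReducedPullbackTransfer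
import Summits.ResolutionOfSingularities.ResolutionOfSingularities.Theorems.PAlterationAssemblyReduction
import Summits.ResolutionOfSingularities.ResolutionOfSingularities.Theorems.PAlterationPialtStubReordering
import Summits.ResolutionOfSingularities.ResolutionOfSingularities.Theorems.PAlterationPialtStubNormalizeRR
import Literature.AlgebraicGeometry.Resolution.SurfaceResolutionReduction
import Literature.AlgebraicGeometry.Resolution.AlterationsPurelyInseparable
import HarnessLib

/-!
# `Pialt` (crux stmt-ResolutionOfSingularities-0555), line `SketchIdeator2` / Card A — exactness

Stubs `pialt_iff_tame_and_patching` and `pialt_iff_modRR` of the lead's skeleton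
`radicially-regular-endgame` (helper file, `--supports stmt-ResolutionOfSingularities-0555`; does
not close the item), together with the glue they share.

Call an integral scheme `Z` **radicially regular (RR)** if an integral regular scheme maps onto it
by a finite, universally injective, surjective morphism, and **locally RR (LRR)** if every point
has an RR open neighbourhood. For a prime `p` write (all ground fields PERFECT of characteristic
`p`, all `X` integral, separated and of finite type):

* `TameResolution_p`: every `X` has a NORMAL modification `π : Z → X` all of whose points are LRR;
* `RadicialPatching_p`: every normal LRR `Z` satisfies the conclusion of the crux;
* `ModRR_p`: every `X` has a normal RR modification.

**Results.**

* `pialtShape_of_radiciallyRegular`, `pialtShape_of_isBirational`, `pialtShape_of_rrModification`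
  (glue): an RR scheme, and more generally the source-side of a modification satisfying the
  conclusion of the crux, passes the conclusion of the crux down.
* `exists_normal_rrModification_of_pialtShape_normalization`: the conclusion of the crux on the
  normalisation of `X` gives a normal RR modification of `X` (normalise, reorder by
  `stub_reordering`, normalise the RR modification by `stub_normalizeRR`, compose).
* `tame_of_pialtShape`: hence a normal modification all of whose points are LRR.
* `pialtPerfect_iff_tame_and_patching`: over perfect fields of characteristic `p`, the crux is
  equivalent to `TameResolution_p ∧ RadicialPatching_p`.
* `pialt_iff_tame_and_patching` (registered): `Pialt ↔ ∀ p, TameResolution_p ∧ RadicialPatching_p`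
  — the cut of the crux is EXACT (perfect ground fields suffice by
  `PalterationThesis.PerfectTransfer.stub_pialtOfPerfect`).
* `pialt_iff_modRR` (registered): `Pialt ↔ ∀ p, ModRR_p` — weak resolution with "regular" relaxed
  to "radicially regular".
-/

set_option linter.dupNamespace false -- mandated namespace of this single-conjunct summit

noncomputable section

open CategoryTheory CategoryTheory.Limits AlgebraicGeometry TopologicalSpace
open Literature.AlgebraicGeometry.Resolution
open Summit.ResolutionOfSingularities.ResolutionOfSingularities.Theses.PAlteration (Pialt)

namespace Summit.ResolutionOfSingularities.ResolutionOfSingularities.Theorems.Pialt.RadiciallyRegular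

/-! ## Glue -/

/-- A radicially regular integral scheme satisfies the conclusion of the crux: the finite
universally injective surjective `W → Z` from the regular `W` is itself the alteration. -/
theorem pialtShape_of_radiciallyRegular (Z : Scheme.{0}) [IsIntegral Z]
    (hZ : ∃ (W : Scheme.{0}) (h : W ⟶ Z), IsIntegral W ∧ Scheme.IsRegular W ∧ IsFinite h ∧
      UniversallyInjective h ∧ Function.Surjective h.base) :
    ∃ (Z' : Scheme.{0}) (g : Z' ⟶ Z), IsProper g ∧ IsIntegral Z' ∧ Scheme.IsRegular Z' ∧
      Function.Surjective g.base ∧ ∃ U : Z.Opens, Dense (U : Set Z) ∧ IsFinite (g ∣_ U) ∧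
        UniversallyInjective (g ∣_ U) := by
  obtain ⟨W, h, hW, hreg, hfin, hui, hsurj⟩ := hZ
  haveI := hW; haveI := hfin; haveI := hui
  haveI : Surjective h := ⟨hsurj⟩
  exact pialtConclusion_of_finite_universallyInjective_surjective h
    (pialtConclusion_of_isRegular W hreg)

/-- The conclusion of the crux DESCENDS along a modification (a proper birational morphism of
integral schemes is a purely inseparable alteration). -/
theorem pialtShape_of_isBirational {Z X : Scheme.{0}} [IsIntegral X] [IsIntegral Z] (π : Z ⟶ X)
    [IsProper π] (hπ : IsBirational π)
    (hZ : ∃ (Z' : Scheme.{0}) (g : Z' ⟶ Z), IsProper g ∧ IsIntegral Z' ∧ Scheme.IsRegular Z' ∧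
      Function.Surjective g.base ∧ ∃ U : Z.Opens, Dense (U : Set Z) ∧ IsFinite (g ∣_ U) ∧
        UniversallyInjective (g ∣_ U)) :
    ∃ (X' : Scheme.{0}) (g : X' ⟶ X), IsProper g ∧ IsIntegral X' ∧ Scheme.IsRegular X' ∧
      Function.Surjective g.base ∧ ∃ U : X.Opens, Dense (U : Set X) ∧ IsFinite (g ∣_ U) ∧
        UniversallyInjective (g ∣_ U) :=
  pialtConclusion_of_isPurelyInseparableAlteration hπ.isPurelyInseparableAlteration hZ

/-- Converse of the reordering lemma (easy direction): a radicially regular modification gives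
the conclusion of the crux. -/
theorem pialtShape_of_rrModification {Z X : Scheme.{0}} [IsIntegral X] [IsIntegral Z]
    (π : Z ⟶ X) [IsProper π] (hπ : IsBirational π)
    (hZ : ∃ (W : Scheme.{0}) (h : W ⟶ Z), IsIntegral W ∧ Scheme.IsRegular W ∧ IsFinite h ∧
      UniversallyInjective h ∧ Function.Surjective h.base) :
    ∃ (X' : Scheme.{0}) (g : X' ⟶ X), IsProper g ∧ IsIntegral X' ∧ Scheme.IsRegular X' ∧
      Function.Surjective g.base ∧ ∃ U : X.Opens, Dense (U : Set X) ∧ IsFinite (g ∣_ U) ∧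
        UniversallyInjective (g ∣_ U) :=
  pialtShape_of_isBirational π hπ (pialtShape_of_radiciallyRegular Z hZ)

/-! ## The cut is exact: `Pialt` over perfect fields ⇔ ModRR ⇔ Tame ∧ Patching -/

/-- `ModRR_p` from the crux (the reordering lemma made global): over a perfect field every
integral separated `X` of finite type satisfying the conclusion of the crux ON ITS NORMALISATION
has a normal, radicially regular modification. Normalise (`isBirational_normalizationι`, finite by
E. Noether), reorder on `X^ν` (`stub_reordering`), normalise the RR modification
(`stub_normalizeRR`) and compose the modifications. -/
theorem exists_normal_rrModification_of_pialtShape_normalization (p : ℕ) (hp : p.Prime)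
    (k : Type) [Field k] [CharP k p] [PerfectField k] (X : Scheme.{0}) (f : X ⟶ Spec (.of k))
    [IsSeparated f] [LocallyOfFiniteType f] [QuasiCompact f] [IsIntegral X]
    (h : ∀ (Y : Scheme.{0}) (g : Y ⟶ Spec (.of k)), IsSeparated g → LocallyOfFiniteType g →
      QuasiCompact g → IsIntegral Y → (∀ y : Y, IsIntegrallyClosed (Y.presheaf.stalk y)) →
      ∃ (Y' : Scheme.{0}) (g' : Y' ⟶ Y), IsProper g' ∧ IsIntegral Y' ∧ Scheme.IsRegular Y' ∧
        Function.Surjective g'.base ∧ ∃ U : Y.Opens, Dense (U : Set Y) ∧ IsFinite (g' ∣_ U) ∧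
          UniversallyInjective (g' ∣_ U)) :
    ∃ (Z : Scheme.{0}) (π : Z ⟶ X), IsProper π ∧ IsBirational π ∧ IsIntegral Z ∧
      (∀ z : Z, IsIntegrallyClosed (Z.presheaf.stalk z)) ∧
      ∃ (W : Scheme.{0}) (h : W ⟶ Z), IsIntegral W ∧ Scheme.IsRegular W ∧ IsFinite h ∧
        UniversallyInjective h ∧ Function.Surjective h.base := by
  -- normalise
  haveI : IsFinite (normalizationι X) :=
    isFinite_normalizationι X NoetherFiniteIntegralClosure_holds f
  have hν : IsBirational (normalizationι X) := isBirational_normalizationι X f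
  haveI : IsSeparated (normalizationι X ≫ f) := inferInstance
  haveI : LocallyOfFiniteType (normalizationι X ≫ f) := inferInstance
  haveI : QuasiCompact (normalizationι X ≫ f) := inferInstance
  have hXν := h (normalization X) (normalizationι X ≫ f) inferInstance inferInstance inferInstance
    inferInstance (isIntegrallyClosed_stalk_normalization X)
  -- reorder on the normalisation
  obtain ⟨Z₀, π₀, hπ₀, hbir₀, hZ₀, hRR₀⟩ := stub_reordering p hp k (normalization X)
    (normalizationι X ≫ f) (isIntegrallyClosed_stalk_normalization X) hXν
  haveI := hπ₀; haveI := hZ₀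
  haveI : LocallyOfFiniteType (π₀ ≫ normalizationι X ≫ f) := inferInstance
  -- normalise the radicially regular modification
  obtain ⟨Z, ν, hν', hbir, hZ, hZn, hRR⟩ := stub_normalizeRR k Z₀ (π₀ ≫ normalizationι X ≫ f) hRR₀
  haveI := hν'; haveI := hZ
  refine ⟨Z, ν ≫ π₀ ≫ normalizationι X, inferInstance, hbir.comp (hbir₀.comp hν), hZ, hZn, hRR⟩

/-- **The crux from tame resolution, pointwise** — `Pialt ⇒ Tame`: over a perfect field, the
conclusion of the crux on the normalisation of `X` yields a normal modification of `X` all of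
whose points are (globally, hence locally) radicially regular. So `stub_tameResolution` is a
CONSEQUENCE of the crux, and the cut `Tame ∧ Patching` is exact. -/
theorem tame_of_pialtShape (p : ℕ) (hp : p.Prime) (k : Type) [Field k] [CharP k p]
    [PerfectField k] (X : Scheme.{0}) (f : X ⟶ Spec (.of k)) [IsSeparated f]
    [LocallyOfFiniteType f] [QuasiCompact f] [IsIntegral X]
    (h : ∀ (Y : Scheme.{0}) (g : Y ⟶ Spec (.of k)), IsSeparated g → LocallyOfFiniteType g →
      QuasiCompact g → IsIntegral Y → (∀ y : Y, IsIntegrallyClosed (Y.presheaf.stalk y)) →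
      ∃ (Y' : Scheme.{0}) (g' : Y' ⟶ Y), IsProper g' ∧ IsIntegral Y' ∧ Scheme.IsRegular Y' ∧
        Function.Surjective g'.base ∧ ∃ U : Y.Opens, Dense (U : Set Y) ∧ IsFinite (g' ∣_ U) ∧
          UniversallyInjective (g' ∣_ U)) :
    ∃ (Z : Scheme.{0}) (π : Z ⟶ X), IsProper π ∧ IsBirational π ∧ IsIntegral Z ∧
      (∀ z : Z, IsIntegrallyClosed (Z.presheaf.stalk z)) ∧
      ∀ z : Z, ∃ U : Z.Opens, z ∈ U ∧ ∃ (W : Scheme.{0}) (h : W ⟶ (U : Scheme.{0})),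
        IsIntegral W ∧ Scheme.IsRegular W ∧ IsFinite h ∧ UniversallyInjective h ∧
          Function.Surjective h.base := by
  obtain ⟨Z, π, hπ, hbir, hZ, hZn, W, h', hW, hreg, hfin, hui, hsurj⟩ :=
    exists_normal_rrModification_of_pialtShape_normalization p hp k X f h
  haveI := hfin; haveI := hui
  refine ⟨Z, π, hπ, hbir, hZ, hZn, fun z => ⟨⊤, trivial, W, h' ≫ (Scheme.topIso Z).inv,
    hW, hreg, inferInstance, MorphismProperty.comp_mem _ _ _ hui inferInstance, ?_⟩⟩
  simp only [Scheme.Hom.comp_base, TopCat.coe_comp]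
  exact (Scheme.homeoOfIso (Scheme.topIso Z).symm).surjective.comp hsurj

/-- **EXACTNESS OF THE CUT.** Over perfect fields of characteristic `p`, the crux restricted to
perfect fields is EQUIVALENT to the conjunction of the two open stubs' statements
(`TameResolution_p ∧ RadicialPatching_p`): neither stub strengthens the crux. -/
theorem pialtPerfect_iff_tame_and_patching (p : ℕ) (hp : p.Prime) :
    (∀ (k : Type) [Field k] [CharP k p] [PerfectField k] (X : Scheme.{0})
      (f : X ⟶ Spec (.of k)), IsSeparated f → LocallyOfFiniteType f → QuasiCompact f →
        IsIntegral X →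
        ∃ (X' : Scheme.{0}) (g : X' ⟶ X), IsProper g ∧ IsIntegral X' ∧ Scheme.IsRegular X' ∧
          Function.Surjective g.base ∧ ∃ U : X.Opens, Dense (U : Set X) ∧ IsFinite (g ∣_ U) ∧
            UniversallyInjective (g ∣_ U)) ↔
    ((∀ (k : Type) [Field k] [CharP k p] [PerfectField k] (X : Scheme.{0})
      (f : X ⟶ Spec (.of k)), IsSeparated f → LocallyOfFiniteType f → QuasiCompact f →
        IsIntegral X →
        ∃ (Z : Scheme.{0}) (π : Z ⟶ X), IsProper π ∧ IsBirational π ∧ IsIntegral Z ∧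
          (∀ z : Z, IsIntegrallyClosed (Z.presheaf.stalk z)) ∧
          ∀ z : Z, ∃ U : Z.Opens, z ∈ U ∧ ∃ (W : Scheme.{0}) (h : W ⟶ (U : Scheme.{0})),
            IsIntegral W ∧ Scheme.IsRegular W ∧ IsFinite h ∧ UniversallyInjective h ∧
              Function.Surjective h.base) ∧
    (∀ (k : Type) [Field k] [CharP k p] [PerfectField k] (Z : Scheme.{0})
      (f : Z ⟶ Spec (.of k)), IsSeparated f → LocallyOfFiniteType f → QuasiCompact f →
        IsIntegral Z → (∀ z : Z, IsIntegrallyClosed (Z.presheaf.stalk z)) →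
        (∀ z : Z, ∃ U : Z.Opens, z ∈ U ∧ ∃ (W : Scheme.{0}) (h : W ⟶ (U : Scheme.{0})),
          IsIntegral W ∧ Scheme.IsRegular W ∧ IsFinite h ∧ UniversallyInjective h ∧
            Function.Surjective h.base) →
        ∃ (Z' : Scheme.{0}) (g : Z' ⟶ Z), IsProper g ∧ IsIntegral Z' ∧ Scheme.IsRegular Z' ∧
          Function.Surjective g.base ∧ ∃ U : Z.Opens, Dense (U : Set Z) ∧ IsFinite (g ∣_ U) ∧
            UniversallyInjective (g ∣_ U))) := by
  refine ⟨fun H => ⟨fun k _ _ _ X f hs hl hq hi => ?_, fun k _ _ _ Z f hs hl hq hi _ _ => ?_⟩,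
    fun H k _ _ _ X f hs hl hq hi => ?_⟩
  · haveI := hs; haveI := hl; haveI := hq; haveI := hi
    exact tame_of_pialtShape p hp k X f fun Y g h1 h2 h3 h4 _ => H k Y g h1 h2 h3 h4
  · exact H k Z f hs hl hq hi
  · haveI := hs; haveI := hl; haveI := hq; haveI := hi
    obtain ⟨Z, π, hπ, hbir, hZ, hZn, hlrr⟩ := H.1 k X f hs hl hq hi
    haveI := hπ; haveI := hZ
    haveI : IsSeparated (π ≫ f) := inferInstance
    haveI : LocallyOfFiniteType (π ≫ f) := inferInstance
    haveI : QuasiCompact (π ≫ f) := inferInstance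
    exact pialtShape_of_isBirational π hbir
      (H.2 k Z (π ≫ f) inferInstance inferInstance inferInstance hZ hZn hlrr)

/-! ## The registered exactness stubs: the crux by name -/

/-- **EXACTNESS OF THE CUT, for the crux by name.** `Pialt` (every integral separated `X` of
finite type over a field of characteristic `p` has a purely inseparable regular alteration, for
every prime `p`) is EQUIVALENT to the conjunction over all primes `p` of `TameResolution_p` (every
such `X` over a PERFECT field has a normal modification all of whose points are locally
radicially regular) and `RadicialPatching_p` (a normal, locally radicially regular such `Z` over a
perfect field satisfies the conclusion of the crux). Perfect ground fields suffice by descent from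
the perfect closure (`PalterationThesis.PerfectTransfer.stub_pialtOfPerfect`). -/
theorem pialt_iff_tame_and_patching :
    Summit.ResolutionOfSingularities.ResolutionOfSingularities.Theses.PAlteration.Pialt ↔
    ∀ p : ℕ, p.Prime → ((∀ (k : Type) [Field k] [CharP k p] [PerfectField k] (X : Scheme.{0})
      (f : X ⟶ Spec (.of k)), IsSeparated f → LocallyOfFiniteType f → QuasiCompact f →
        IsIntegral X → ∃ (Z : Scheme.{0}) (π : Z ⟶ X), IsProper π ∧ IsBirational π ∧
          IsIntegral Z ∧ (∀ z : Z, IsIntegrallyClosed (Z.presheaf.stalk z)) ∧ ∀ z : Z,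
            ∃ U : Z.Opens, z ∈ U ∧ ∃ (W : Scheme.{0}) (h : W ⟶ (U : Scheme.{0})),
              IsIntegral W ∧ Scheme.IsRegular W ∧ IsFinite h ∧ UniversallyInjective h ∧
                Function.Surjective h.base) ∧
    (∀ (k : Type) [Field k] [CharP k p] [PerfectField k] (Z : Scheme.{0})
      (f : Z ⟶ Spec (.of k)), IsSeparated f → LocallyOfFiniteType f → QuasiCompact f →
        IsIntegral Z → (∀ z : Z, IsIntegrallyClosed (Z.presheaf.stalk z)) →
        (∀ z : Z, ∃ U : Z.Opens, z ∈ U ∧ ∃ (W : Scheme.{0}) (h : W ⟶ (U : Scheme.{0})),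
          IsIntegral W ∧ Scheme.IsRegular W ∧ IsFinite h ∧ UniversallyInjective h ∧
            Function.Surjective h.base) →
        ∃ (Z' : Scheme.{0}) (g : Z' ⟶ Z), IsProper g ∧ IsIntegral Z' ∧ Scheme.IsRegular Z' ∧
          Function.Surjective g.base ∧ ∃ U : Z.Opens, Dense (U : Set Z) ∧ IsFinite (g ∣_ U) ∧
            UniversallyInjective (g ∣_ U))) := by
  refine ⟨fun hP p hp => ⟨fun k _ _ _ X f hs hl hq hi => ?_, fun k _ _ _ Z f hs hl hq hi _ _ => ?_⟩,
    fun H => ?_⟩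
  · haveI := hs; haveI := hl; haveI := hq; haveI := hi
    exact tame_of_pialtShape p hp k X f fun Y g h1 h2 h3 h4 _ => hP p hp k Y g h1 h2 h3 h4
  · exact hP p hp k Z f hs hl hq hi
  · intro p hp k _ _ X f hs hl hq hi
    haveI : Fact p.Prime := ⟨hp⟩
    exact PalterationThesis.PerfectTransfer.stub_pialtOfPerfect p k
      (fun Y g hs' hl' hq' hi' => (pialtPerfect_iff_tame_and_patching p hp).mpr (H p hp)
        (PerfectClosure k p) Y g hs' hl' hq' hi') X f

/-- **`Pialt ⇔ ModRR`.** `Pialt` is EQUIVALENT to: for every prime `p`, every integral separated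
`X` of finite type over a PERFECT field of characteristic `p` has a NORMAL, RADICIALLY REGULAR
modification — a proper birational `π : Z → X` with `Z` integral and normal, dominated by an
integral regular `W` through a finite, universally injective, surjective `W → Z` (weak resolution
with "regular" relaxed to "radicially regular"). (`⇒`: the reordering lemma on the normalisation,
`exists_normal_rrModification_of_pialtShape_normalization`; `⇐`: `pialtShape_of_rrModification`
over the perfect closure and `PalterationThesis.PerfectTransfer.stub_pialtOfPerfect`.) -/
theorem pialt_iff_modRR :
    Summit.ResolutionOfSingularities.ResolutionOfSingularities.Theses.PAlteration.Pialt ↔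
    ∀ p : ℕ, p.Prime → ∀ (k : Type) [Field k] [CharP k p] [PerfectField k] (X : Scheme.{0})
      (f : X ⟶ Spec (.of k)), IsSeparated f → LocallyOfFiniteType f → QuasiCompact f →
        IsIntegral X → ∃ (Z : Scheme.{0}) (π : Z ⟶ X), IsProper π ∧ IsBirational π ∧
          IsIntegral Z ∧ (∀ z : Z, IsIntegrallyClosed (Z.presheaf.stalk z)) ∧
          ∃ (W : Scheme.{0}) (h : W ⟶ Z), IsIntegral W ∧ Scheme.IsRegular W ∧ IsFinite h ∧
            UniversallyInjective h ∧ Function.Surjective h.base := by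
  refine ⟨fun hP p hp k _ _ _ X f hs hl hq hi => ?_, fun H => ?_⟩
  · haveI := hs; haveI := hl; haveI := hq; haveI := hi
    exact exists_normal_rrModification_of_pialtShape_normalization p hp k X f
      fun Y g h1 h2 h3 h4 _ => hP p hp k Y g h1 h2 h3 h4
  · intro p hp k _ _ X f hs hl hq hi
    haveI : Fact p.Prime := ⟨hp⟩
    refine PalterationThesis.PerfectTransfer.stub_pialtOfPerfect p k
      (fun Y g hs' hl' hq' hi' => ?_) X f
    haveI := hs'; haveI := hl'; haveI := hq'; haveI := hi'
    obtain ⟨Z, π, hπ, hbir, hZ, _, hRR⟩ := H p hp (PerfectClosure k p) Y g hs' hl' hq' hi'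
    haveI := hπ; haveI := hZ
    exact pialtShape_of_rrModification π hbir hRR

end Summit.ResolutionOfSingularities.ResolutionOfSingularities.Theorems.Pialt.RadiciallyRegular

end
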